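import Mathlib
import HarnessLib
import Summits.ValiantsHypothesis.ValiantsHypothesis.Theses.MonotoneRestoration
import Literature.Computability.AlgebraicComplexity.ArithCircuit
import Literature.Computability.AlgebraicComplexity.ArithCircuitProofs
import Literature.Computability.AlgebraicComplexity.MonotoneStructure
import Literature.Computability.AlgebraicComplexity.PermanentIrreducible
import Literature.ModelTheory.FiniteModelTheory.CkEquiv
import Summits.ValiantsHypothesis.ValiantsHypothesis.Theorems.MonotoneRestorationMonotoneRestorationQPCosetCount
import Summits.ValiantsHypothesis.ValiantsHypothesis.Theorems.MonotoneRestorationMonotoneRestorationQPSymmetricLB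
import Summits.ValiantsHypothesis.ValiantsHypothesis.Theorems.MonotoneRestorationMonotoneRestorationQPSupportSymmetrisation
import Summits.ValiantsHypothesis.ValiantsHypothesis.Theorems.MonotoneRestorationMonotoneRestorationQPSparseRegime
import Summits.ValiantsHypothesis.ValiantsHypothesis.Theorems.MonotoneRestorationMonotoneRestorationQPBeta
import Literature.Computability.AlgebraicComplexity.SymmetricArithCircuit
import Literature.Computability.AlgebraicComplexity.DawarWilsenach2025Proofs
import Literature.GroupTheory.PermutationGroups.SmallIndexSubgroups
import Summits.ValiantsHypothesis.ValiantsHypothesis.Theorems.MonotoneRestorationQP.Negative.LoadBearing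
import Summits.ValiantsHypothesis.ValiantsHypothesis.Theorems.MonotoneRestorationMonotoneRestorationQPPermSupportCount
import Summits.ValiantsHypothesis.ValiantsHypothesis.Theorems.MonotoneRestorationMonotoneRestorationQPEsymmRowSumsComplexity

/-! TTRL-lite variant V20223 of stmt-ValiantsHypothesis-15886 -/

set_option linter.dupNamespace false

namespace Summit.ValiantsHypothesis.ValiantsHypothesis.Theorems

open Summit.ValiantsHypothesis.ValiantsHypothesis.Theses.MonotoneRestoration
open Literature.Computability.AlgebraicComplexity

/-- TTRL-lite variant V20223 of `stmt-ValiantsHypothesis-15886` (relative row-sum provision):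
any list of fan-in-`≤ 2` gates over `ℝ≥0` extends, as a prefix, by exactly `#s + 1` further
fan-in-`≤ 2` gates to a list providing the row sum `Σ_{i ∈ s} X (x i)` (a `0` gate, then one
`+ X (x i)` gate per element of `s`). Unlike an absolute bound `L(Σ X) ≤ n`, this relative form
composes under gate sharing. Immediate from the tree's `esymmRowSumsCplx_rowSum` at `k := ℝ≥0`.
[folklore; cf. Bürgisser 2000, Def. 2.1] -/
theorem stub_esymmRowSums_complexity_var20223 :
    ∀ (σ ι : Type) (x : ι → σ) (s : Finset ι) (gs : List (ArithCircuit.Gate NNReal σ)),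
      (∀ g ∈ gs, g.fanIn ≤ 2) →
      ∃ gs' : List (ArithCircuit.Gate NNReal σ), gs <+: gs' ∧ (∀ g ∈ gs', g.fanIn ≤ 2) ∧
        gs'.length = gs.length + (s.card + 1) ∧
        (∑ i ∈ s, (MvPolynomial.X (x i) : MvPolynomial σ NNReal)) ∈ ArithCircuit.gateValues gs' :=
  fun _σ _ι x s => esymmRowSumsCplx_rowSum x s

end Summit.ValiantsHypothesis.ValiantsHypothesis.Theorems
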